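import Summits.HodgeConjecture.HodgeConjecture.Theorems.PadicSemiregularLiftHodgeFermatVarietiesLevelRaise
import HarnessLib

/-!
# Level raising maps the printed supply of level `M` into the printed supply of level `kM` — stub `stub_levelRaise_mem_supply`, line `cancel-by-any-claim-lattice`, crux `HodgeFermatVarieties` (stmt-HodgeConjecture-1334)

Level raising `ψ_k : ℤ/M → ℤ/kM`, `x ↦ k⟨x⟩` (`⟨x⟩ ∈ [0, M)` the representative) — the arithmetic
shadow of the pull-back of characters along the `μ`-equivariant morphism `π : Xⁿ_{kM} → Xⁿ_M`,
`[xᵢ] ↦ [xᵢᵏ]` (Shioda–Katsura 1979 §1; Aoki 1987 p. 387, the elements `g·σ`; Cor. 2-3) — is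
additive (`levelRaise_add`: `k((⟨a⟩ + ⟨b⟩) mod M) = (k⟨a⟩ + k⟨b⟩) mod kM`), hence commutes with
negation, multiset sums and multiplication by naturals (`levelRaise_neg`, `sum_levelRaise`,
`levelRaise_natCast_mul`), is injective for `k ≥ 1` (`levelRaise_ne_zero`) and has `⟨ψ_k x⟩ = k⟨x⟩`
(`val_levelRaise`). Everything is stated for the raw expression `((k * ZMod.val a : ℕ) : ZMod (k * M))`
of the line's notation `LevelRaise[k, M, s]` (no bundled homomorphism is introduced).

PROVED here (`stub_levelRaise_mem_supply`): `ψ_k` maps each of the four components of the printed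
supply `Supply[M]` into the same component of `Supply[kM]`:

* pairs `{a, -a}` (`a ≠ 0`) go to pairs `{ψa, -ψa}` (`ψa ≠ 0`);
* Hodge multisets with four elements go to Hodge multisets with four elements
  (`isHodgeMultiset_levelRaise`, the landed arithmetic part (a) of level change);
* semi-decomposable Hodge sextuples `t + u` (`#t = #u = 3`, `Σt = Σu = 0`) go to `ψt + ψu`, again
  Hodge and semi-decomposable since `ψ` is additive (`Σ ψt = ψ(Σt) = 0`);
* Aoki's standard elements `σ_{p,a} = {a + j·(M/p) : j < p} + {-(p a)}` (`p` an odd prime dividing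
  `M`, `(M/p)/gcd(⟨a⟩, M/p) > 2`) go ENTRYWISE to `σ_{p,ψa}` of level `kM`:
  `ψ(a + j (M/p)) = ψa + j (kM/p)`, `ψ(-(p a)) = -(p ψa)`, with the same side condition
  `(kM/p)/gcd(k⟨a⟩, kM/p) = (M/p)/gcd(⟨a⟩, M/p)`.

Only the arithmetic of `ℤ/M`; no geometry. NOT here: the reachability statements of the line (the
neighbouring stubs) and the geometric half (b) of level change.

## References

* [Aoki1987] N. Aoki, Some new algebraic cycles on Fermat varieties, J. Math. Soc. Japan 39 (1987)
  385–396, §1 p. 387 (the elements `g·σ`, the standard elements `σ_{p,i}`) and Cor. 2-3.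
* [ShiodaKatsura1979] T. Shioda, T. Katsura, On Fermat varieties, Tôhoku Math. J. 31 (1979)
  97–115, §1.
* [Shioda1979PJA] T. Shioda, Proc. Japan Acad. 55A (1979) 111–114, §1.
-/

-- `HodgeConjecture.HodgeConjecture` repeats by the single-problem Summits layout (as in every sibling file).
set_option linter.dupNamespace false

noncomputable section

open Finset
open Literature.AlgebraicGeometry.HodgeTheory Literature.AlgebraicGeometry.HodgeTheory.FermatCharacter

namespace Summit.HodgeConjecture.HodgeConjecture.Theorems.CancelByAnyClaimLattice.LevelRaiseSupply

/-- `Supply[M]` — the printed supply of level `M` (local notation of the line, verbatim). -/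
local notation3 (prettyPrint := false) "Supply[" M "]" =>
  ({s : Multiset (ZMod M) | ∃ a : ZMod M, a ≠ 0 ∧ s = ({a, -a} : Multiset (ZMod M))} ∪
    {s : Multiset (ZMod M) | IsHodgeMultiset s ∧ Multiset.card s = 4} ∪
    {s : Multiset (ZMod M) | IsHodgeMultiset s ∧ IsSemiDecomposable s} ∪
    {s : Multiset (ZMod M) | ∃ (p : ℕ) (a : ZMod M), p.Prime ∧ p ≠ 2 ∧ p ∣ M ∧
        2 < (M / p) / Nat.gcd (ZMod.val a) (M / p) ∧
        s = Multiset.map (fun j : ℕ => a + (j : ZMod M) * ((M / p : ℕ) : ZMod M)) (Multiset.range p) +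
              {-((p : ZMod M) * a)}} : Set (Multiset (ZMod M)))

/-- `LevelRaise[k, m, s]` — level raising `s ↦ k • s` (local notation of the line, verbatim). -/
local notation3 (prettyPrint := false) "LevelRaise[" k ", " m ", " s "]" =>
  Multiset.map (fun a : ZMod m => ((k * ZMod.val a : ℕ) : ZMod (k * m))) s

variable {k M : ℕ}

/-! ### Arithmetic of `ψ_k : ℤ/M → ℤ/kM`, `a ↦ k⟨a⟩` -/

/-- **`ψ_k` is additive**: `k · ((⟨a⟩ + ⟨b⟩) mod M) ≡ k⟨a⟩ + k⟨b⟩ (mod kM)`, because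
`k (x mod M) = kx mod kM` (`Nat.mul_mod_mul_left`). [cite: Aoki1987, §1 p. 387 (the elements g·σ of level m coming from level m/g)] -/
theorem levelRaise_add [NeZero M] (a b : ZMod M) :
    ((k * (a + b).val : ℕ) : ZMod (k * M)) =
      ((k * a.val : ℕ) : ZMod (k * M)) + ((k * b.val : ℕ) : ZMod (k * M)) := by
  rw [ZMod.val_add, ← Nat.mul_mod_mul_left, ZMod.natCast_mod, Nat.mul_add, Nat.cast_add]

/-- `ψ_k 0 = 0`. [folklore] -/
theorem levelRaise_zero : ((k * (0 : ZMod M).val : ℕ) : ZMod (k * M)) = 0 := by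
  rw [ZMod.val_zero, Nat.mul_zero, Nat.cast_zero]

/-- **`ψ_k (-a) = -ψ_k a`** (from additivity and `ψ_k 0 = 0`). [folklore] -/
theorem levelRaise_neg [NeZero M] (a : ZMod M) :
    ((k * (-a).val : ℕ) : ZMod (k * M)) = -((k * a.val : ℕ) : ZMod (k * M)) := by
  refine eq_neg_of_add_eq_zero_right ?_
  rw [← levelRaise_add, add_neg_cancel, levelRaise_zero]

/-- **`ψ_k (n mod M) = kn mod kM`** for a natural number `n`. [folklore] -/
theorem levelRaise_natCast (n : ℕ) :
    ((k * (n : ZMod M).val : ℕ) : ZMod (k * M)) = ((k * n : ℕ) : ZMod (k * M)) := by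
  rw [ZMod.val_natCast, ← Nat.mul_mod_mul_left, ZMod.natCast_mod]

/-- **`ψ_k (n · a) = n · ψ_k a`** for a natural number `n` (`n a = (n⟨a⟩) mod M`, then
`levelRaise_natCast`). [folklore] -/
theorem levelRaise_natCast_mul [NeZero M] (n : ℕ) (a : ZMod M) :
    ((k * ((n : ZMod M) * a).val : ℕ) : ZMod (k * M)) =
      (n : ZMod (k * M)) * ((k * a.val : ℕ) : ZMod (k * M)) := by
  have h : (n : ZMod M) * a = ((n * a.val : ℕ) : ZMod M) := by
    rw [Nat.cast_mul, ZMod.natCast_zmod_val]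
  rw [h, levelRaise_natCast, Nat.mul_left_comm, Nat.cast_mul]

/-- **`ψ_k` commutes with multiset sums**: `Σ (k • s) = ψ_k (Σ s)`. [folklore] -/
theorem sum_levelRaise [NeZero M] (s : Multiset (ZMod M)) :
    (LevelRaise[k, M, s]).sum = ((k * (s.sum).val : ℕ) : ZMod (k * M)) := by
  induction s using Multiset.induction_on with
  | empty => rw [Multiset.map_zero, Multiset.sum_zero, Multiset.sum_zero, levelRaise_zero]
  | cons a s ih => rw [Multiset.map_cons, Multiset.sum_cons, Multiset.sum_cons, ih, levelRaise_add]

/-- **`⟨ψ_k a⟩ = k⟨a⟩`** for `k ≥ 1`, since `k⟨a⟩ < kM`. [folklore] -/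
theorem val_levelRaise [NeZero M] (hk : 0 < k) (a : ZMod M) :
    (((k * a.val : ℕ) : ZMod (k * M))).val = k * a.val :=
  ZMod.val_cast_of_lt (Nat.mul_lt_mul_of_pos_left (ZMod.val_lt a) hk)

/-- **`ψ_k` is injective** for `k ≥ 1`: `kM ∣ k⟨a⟩` forces `M ∣ ⟨a⟩ < M`, i.e. `a = 0`. [folklore] -/
theorem levelRaise_ne_zero [NeZero M] (hk : 0 < k) {a : ZMod M} (ha : a ≠ 0) :
    ((k * a.val : ℕ) : ZMod (k * M)) ≠ 0 := by
  intro h0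
  rw [ZMod.natCast_eq_zero_iff] at h0
  exact ha ((ZMod.val_eq_zero a).mp
    (Nat.eq_zero_of_dvd_of_lt ((Nat.mul_dvd_mul_iff_left hk).mp h0) (ZMod.val_lt a)))

/-! ### The stub -/

/-- **S8 `stub_levelRaise_mem_supply` — level raising maps the printed supply into the printed
supply.** For `k ≥ 1` the map `ψ_k : ℤ/M → ℤ/kM`, `x ↦ k⟨x⟩` (additive, commutes with negation,
`⟨ψ_k x⟩ = k⟨x⟩`, injective) sends: a pair `{a, -a}` (`a ≠ 0`) to the pair `{ψ_k a, -ψ_k a}`; a Hodge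
4-multiset to a Hodge 4-multiset and a Hodge semi-decomposable sextuple `t + u` to the Hodge
semi-decomposable sextuple `ψ_k t + ψ_k u` (`isHodgeMultiset_levelRaise` and `Multiset.card_map`; a
zero-sum triple stays zero-sum by additivity, `sum_levelRaise`); and Aoki's standard element
`σ_{p,a} = {a + j d : j < p} + {-(p a)}` of level `M` (`p` an odd prime, `p ∣ M`, `d = M/p`,
`2 < d/gcd(⟨a⟩, d)`) ENTRYWISE to `σ_{p, ψ_k a}` of level `kM` (`ψ_k(a + j d) = ψ_k a + j (kM/p)`,
`ψ_k(-(p a)) = -(p ψ_k a)`), with the same side condition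
(`(kM/p)/gcd(k⟨a⟩, kM/p) = d/gcd(⟨a⟩, d)`). This is the statement that the pull-back `π^*` along
`π : Xⁿ_{kM} → Xⁿ_M`, `[xᵢ] ↦ [xᵢᵏ]`, preserves the shape of each printed family of algebraic classes.
[cite: Aoki1987, §1 p. 387 (g·σ, σ_{p,i}) and Cor. 2-3 (p. 388)] -/
theorem stub_levelRaise_mem_supply :
    ∀ (M k : ℕ) [NeZero M], 0 < k → ∀ u : Multiset (ZMod M), u ∈ Supply[M] →
      LevelRaise[k, M, u] ∈ Supply[k * M] := by
  intro M k _ hk u hu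
  simp only [Set.mem_union, Set.mem_setOf_eq] at hu ⊢
  rcases hu with ((⟨a, ha, rfl⟩ | ⟨hH, hc⟩) | ⟨hH, hsemi⟩) | ⟨p, a, hp, hp2, hpM, hside, rfl⟩
  · -- pairs `{a, -a} ↦ {ψ a, -ψ a}`
    refine Or.inl (Or.inl (Or.inl ⟨((k * a.val : ℕ) : ZMod (k * M)), levelRaise_ne_zero hk ha, ?_⟩))
    simp only [Multiset.insert_eq_cons, Multiset.map_cons, Multiset.map_singleton]
    rw [levelRaise_neg]
  · -- Hodge multisets with four elements
    have hu0 : u ≠ 0 := by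
      rintro rfl
      simp at hc
    exact Or.inl (Or.inl (Or.inr
      ⟨isHodgeMultiset_levelRaise M k hk u hu0 hH, by rw [Multiset.card_map, hc]⟩))
  · -- semi-decomposable Hodge sextuples
    obtain ⟨t, v, ht, hv, hts, hvs, rfl⟩ := hsemi
    have hu0 : t + v ≠ 0 := by
      intro h
      have hcard := congrArg Multiset.card h
      rw [Multiset.card_add, ht, hv] at hcard
      simp at hcard
    refine Or.inl (Or.inr ⟨isHodgeMultiset_levelRaise M k hk _ hu0 hH, ?_⟩)
    refine ⟨LevelRaise[k, M, t], LevelRaise[k, M, v],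
      by rw [Multiset.card_map, ht], by rw [Multiset.card_map, hv], ?_, ?_, Multiset.map_add _ _ _⟩
    · rw [sum_levelRaise, hts, levelRaise_zero]
    · rw [sum_levelRaise, hvs, levelRaise_zero]
  · -- standard elements `σ_{p,a} ↦ σ_{p,ψ a}`
    refine Or.inr ⟨p, ((k * a.val : ℕ) : ZMod (k * M)), hp, hp2, hpM.mul_left k, ?_, ?_⟩
    · -- the side condition `(kM/p)/gcd(k⟨a⟩, kM/p) = (M/p)/gcd(⟨a⟩, M/p)`
      rw [val_levelRaise hk, Nat.mul_div_assoc k hpM, Nat.gcd_mul_left,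
        Nat.mul_div_mul_left _ _ hk]
      exact hside
    · rw [Multiset.map_add, Multiset.map_singleton, Multiset.map_map]
      congr 1
      · refine Multiset.map_congr rfl fun j _ => ?_
        simp only [Function.comp_apply]
        rw [levelRaise_add, levelRaise_natCast_mul, levelRaise_natCast, Nat.mul_div_assoc k hpM]
      · rw [levelRaise_neg, levelRaise_natCast_mul]

end Summit.HodgeConjecture.HodgeConjecture.Theorems.CancelByAnyClaimLattice.LevelRaiseSupply

end
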